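import Literature.Computability.AlgebraicComplexity.RectangularExponentCertReduction
import Literature.Computability.AlgebraicComplexity.LaserValueCertificate
import HarnessLib

/-!
# The square record `ω ≤ 2.371339` (`advxxz2025_omega_le`): its minimal hypotheses in the tree's
three currencies — proved reductions

Topic `Literature/Computability/AlgebraicComplexity`; companion of `RectangularExponent.lean` (the
named fact `advxxz2025_omega_le : omega ℂ ≤ 2.371339`, Alman–Duan–Vassilevska Williams–Xu–Xu–Zhou,
*More asymmetry yields faster matrix multiplication*, SODA 2025, arXiv:2404.16349: abstract
"`ω < 2.371339`", §7 "In particular, we showed that `ω ≤ 2.371339`", Table 1 row `k = 1`) and of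
`RectangularExponentLaserCertificate.lean` (the table-indexed degeneration predicate
`CW5DegenerationCertificate`, the named fact `advxxz2025_laserDegeneration` = the certificate for
all 13 rows of Table 1, and the PROVED `advxxz2025_omega_le_of_laserDegeneration`).

The printed proof of the record is: (1) `R̃(CW_5) ≤ 7` (§3.6) and (2) Schönhage's asymptotic sum
inequality (Thm. 3.2) — both theorems of the tree — applied to (3) the output of the laser method with
more asymmetric hashing on `CW_5^{⊗4}` (§4–§6: Thm. 4.2, Thm. 5.3, Lemma 5.5, Thms. 6.2, 6.4) at the
`κ = 1` parameter file of §7 (`data/W1.00_2.371339.mat`, stored objective `2.371338900543`, exactly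
re-certified below `2.371339`, see the audit in `RectangularExponentLaserCertificate.lean`).  Layer (3)
is the one unformalised layer.  This file records, as PROVED implications and nothing else, the exact
hypothesis the record needs in each of the three shapes in which the tree states laser-method output,
so that whichever lands first discharges `advxxz2025_omega_le` in one line:

* `advxxz2025_laserDegeneration.row_one` — the 13-row fact restricts to the single row
  `CW5DegenerationCertificate [(1, 2.371339)]` (the other twelve rows of Table 1 are not needed);
* `advxxz2025_omega_le_of_cw5Certificate_row` — **that single-row certificate already gives
  `ω ≤ 2.371339`** (layers (1)–(2): `omegaRect_le_of_cw5DegenerationCertificate` and `ω(1,1,1) = ω`);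
* `advxxz2025_omega_le_of_forall_polyDegeneratesTo` — the square-shape form consumed by the assembly
  `LaserDegenerationBound.omega_le_of_forall_polyDegeneratesTo`: degenerations
  `⟨M⟩ ⊗ CW_5^{⊗N} ⊵ ⟨t⟩ ⊗ ⟨m,m,m⟩` with `M · 7^N ≤ t · m^{2.371339+δ}` for every `δ > 0`;
  `forall_polyDegeneratesTo_square_of_cw5Certificate_row` — the single-row certificate supplies them
  (restrict `⟨a, B, a⟩`, `B ≥ a`, to `⟨a, a, a⟩`);
* `advxxz2025_omega_le_of_hasLaserValue` — the Le Gall VALUE form (`LaserValue.lean`): any tensor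
  `T ≤ CW_5^{⊗c}` with `V_{2.371339}(T) > 7^c` gives the record, through
  `cw5Certificate_of_hasLaserValue`.  (The best value the tree proves is at `ρ = 2.37295`, `c = 4`,
  `BigCwFourthCertificate.lean`; the symmetric laser method behind values is not known to reach
  `2.371339` — the record's `0.0016` below it is the asymmetric hashing of DWZ 2023 / VXXZ 2024 /
  ADVXXZ 2025, whose output is a certificate, not a value.)

Everything here is proved; no definitions, no named facts (D-0026).  The honest trust base of
`advxxz2025_omega_le` in this tree is therefore exactly `CW5DegenerationCertificate [(1, 2.371339)]`,
i.e. layer (3) at one parameter file.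

## References

* J. Alman, R. Duan, V. Vassilevska Williams, Y. Xu, Z. Xu, R. Zhou, *More asymmetry yields faster
  matrix multiplication*, SODA 2025, arXiv:2404.16349: abstract; §1 Table 1 (row `k = 1`); §3.2–§3.6
  (Thm. 3.2, `R̃(CW_q) ≤ q + 2`); §7 "Numerical Result" (procedure of degeneration, limiting condition
  `lim_{ε→0} lim_{n→∞} V^{1/n} · min{A, B^{1/κ}, C}^{ω'/n} ≥ (q+2)^{2^{ℓ*−1}}`, "we showed that
  `ω ≤ 2.371339`", parameters at osf.io/mw5ak). [AlmanDuanVassilevskaWilliamsXuXuZhou2025]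
* F. Le Gall, *Powers of tensors and fast matrix multiplication*, ISSAC 2014, arXiv:1401.7714,
  Def. 2.1, Thm. 2.2 (values). [LeGall2014]
-/

noncomputable section

namespace Literature.Computability.AlgebraicComplexity

open Literature.Barriers.MatrixMultiplication

/-! ## The single row behind the record -/

/-- The 13-row laser-method degeneration of ADVXXZ 2025 (`advxxz2025_laserDegeneration`) restricts to
the single row `(k, b) = (1, 2.371339)` of Table 1. [cite: AlmanDuanVassilevskaWilliamsXuXuZhou2025, §1 Table 1 (row k = 1)] -/
theorem advxxz2025_laserDegeneration.row_one (h : advxxz2025_laserDegeneration) :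
    CW5DegenerationCertificate [((1 : ℝ), (2.371339 : ℝ))] := by
  refine CW5DegenerationCertificate.mono h fun k b' hkb' => ⟨b', ?_, le_rfl⟩
  obtain ⟨rfl, rfl⟩ : k = 1 ∧ b' = 2.371339 := by simpa using hkb'
  norm_num [advxxz2025Table]

/-- **The record from its own row**: a `CW_5` degeneration certificate for the single row
`(1, 2.371339)` — the laser method of §4–§6 run at the `κ = 1` parameter file of §7 — gives
`ω ≤ 2.371339` over `ℂ`, by `R̃(CW_5) ≤ 7`, Schönhage's asymptotic sum inequality
(`omegaRect_le_of_cw5DegenerationCertificate`) and `ω(1,1,1) = ω`.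
[cite: AlmanDuanVassilevskaWilliamsXuXuZhou2025, §7 (limiting condition at κ = 1: "ω ≤ 2.371339")] -/
theorem advxxz2025_omega_le_of_cw5Certificate_row
    (h : CW5DegenerationCertificate [((1 : ℝ), (2.371339 : ℝ))]) : advxxz2025_omega_le := by
  have h1 : omegaRect ℂ 1 1 1 ≤ 2.371339 :=
    omegaRect_le_of_cw5DegenerationCertificate h (by simp) zero_le_one
  unfold advxxz2025_omega_le
  rwa [omegaRect_one_one_one] at h1

/-! ## The square-shape form -/

/-- **Square-shape degenerations give the record**: if for every `δ > 0` some `⟨M⟩ ⊗ CW_5^{⊗N}`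
degenerates over `ℂ[λ]` into `⟨t⟩ ⊗ ⟨m, m, m⟩`, `t ≥ 1`, `m ≥ 2`, with `M · 7^N ≤ t · m^{2.371339+δ}`,
then `ω ≤ 2.371339` — the proved assembly `omega_le_of_forall_polyDegeneratesTo` at `q = 5`,
`(5 : ℝ) + 2 = 7`. [cite: AlmanDuanVassilevskaWilliamsXuXuZhou2025, §7 (procedure of degeneration, κ = 1)] -/
theorem advxxz2025_omega_le_of_forall_polyDegeneratesTo
    (h : ∀ δ : ℝ, 0 < δ → ∃ t m M N : ℕ, 1 ≤ t ∧ 2 ≤ m ∧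
      PolyDegeneratesTo (kroneckerTensor (unitTensor ℂ M) (kroneckerPow (bigCwTensor ℂ 5) N))
        (kroneckerTensor (unitTensor ℂ t) (matMulTensor ℂ m m m)) ∧
      (M : ℝ) * 7 ^ N ≤ (t : ℝ) * (m : ℝ) ^ ((2.371339 : ℝ) + δ)) :
    advxxz2025_omega_le := by
  unfold advxxz2025_omega_le
  refine omega_le_of_forall_polyDegeneratesTo ℂ (q := 5) fun δ hδ => ?_
  obtain ⟨t, m, M, N, ht, hm, hdeg, hcount⟩ := h δ hδ
  refine ⟨t, m, M, N, ht, hm, hdeg, ?_⟩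
  have h7 : ((5 : ℕ) : ℝ) + 2 = 7 := by norm_num
  rw [h7]
  exact hcount

/-- The single-row certificate supplies the square-shape degenerations: restrict `⟨a, B, a⟩`
(`B ≥ a^1 = a`) to `⟨a, a, a⟩` (zeroing out columns is a restriction, hence a degeneration).
[cite: AlmanDuanVassilevskaWilliamsXuXuZhou2025, §3.2–§3.3 (restriction ⊆ degeneration)] -/
theorem forall_polyDegeneratesTo_square_of_cw5Certificate_row
    (h : CW5DegenerationCertificate [((1 : ℝ), (2.371339 : ℝ))]) :
    ∀ δ : ℝ, 0 < δ → ∃ t m M N : ℕ, 1 ≤ t ∧ 2 ≤ m ∧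
      PolyDegeneratesTo (kroneckerTensor (unitTensor ℂ M) (kroneckerPow (bigCwTensor ℂ 5) N))
        (kroneckerTensor (unitTensor ℂ t) (matMulTensor ℂ m m m)) ∧
      (M : ℝ) * 7 ^ N ≤ (t : ℝ) * (m : ℝ) ^ ((2.371339 : ℝ) + δ) := by
  intro δ hδ
  obtain ⟨N, t, V, a, B, -, -, hV, ha, haB, hdeg, hnum⟩ := h 1 2.371339 (by simp) δ hδ
  have haB' : a ≤ B := by
    rw [Real.rpow_one] at haB
    exact_mod_cast haB
  refine ⟨V, a, t, N, hV, ha, hdeg.trans_restrictsTo ?_, hnum⟩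
  classical
  exact (TensorRestrictsTo.refl (unitTensor ℂ V)).kronecker
    (tensorRestrictsTo_matMulTensor_of_le ℂ le_rfl haB' le_rfl)

/-! ## The value form -/

/-- **A Le Gall value at `ρ = 2.371339` would give the record**: if `CW_5^{⊗c} ≥ T` (`c ≥ 1`) and
`V_{2.371339}(T) ≥ v > 7^c`, then `ω ≤ 2.371339` (`cw5Certificate_of_hasLaserValue`, then the
single-row reduction).  No such value is known; the tree's best is `ρ = 2.37295` at `c = 4`
(`BigCwFourthCertificate.lean`). [cite: LeGall2014, Thm. 2.2] [cite: AlmanDuanVassilevskaWilliamsXuXuZhou2025, §7] -/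
theorem advxxz2025_omega_le_of_hasLaserValue {ι' κ' μ' : Type} [Fintype ι'] [Fintype κ']
    [Fintype μ'] [DecidableEq ι'] [DecidableEq κ'] [DecidableEq μ'] {c : ℕ} (hc : 1 ≤ c)
    {T : ι' → κ' → μ' → ℂ} (hT : TensorRestrictsTo (kroneckerPow (bigCwTensor ℂ 5) c) T)
    {v : ℝ} (h : HasLaserValue 2.371339 T v) (h7 : (7 : ℝ) ^ c < v) : advxxz2025_omega_le :=
  advxxz2025_omega_le_of_cw5Certificate_row (cw5Certificate_of_hasLaserValue hc hT (by norm_num) h h7)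

end Literature.Computability.AlgebraicComplexity

end
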